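import Mathlib.Analysis.InnerProductSpace.Calculus
import Mathlib.Analysis.Calculus.MeanValue
import Mathlib.Analysis.Calculus.Deriv.Mul
import HarnessLib

/-!
# K1L `LagrangianRenormalisationStep(Design)` (K1L_D, stmt-AnomalousDissipation-27980; aside 24912), stub `stub_cellLawV0_IS`
# — the ABSTRACT SLOW-GRAPH LEVER, part 1: Chang's Riccati graph stays in the INVARIANT BALL `‖L‖ ≤ 2δ/(γ−s₀)`
# (`SlowGraphSketch` G1 `RiccatiInvariantBall`, VERBATIM body, PROVED; helper; `--supports stmt-AnomalousDissipation-27980`; word-independent)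

Summits-side helper file of route `SolenoidalFractalHomogenisation` (planner ad-ideate-p5's STUB-PLAN for `stub_cellLawV`,
`Cruxes/LagrangianRenormalisationStep/STUB-IDEAS-stub_cellLawV-p5.md` §1 (V) steps V1/V2 and §7 (a) (tenure D24-1: the family shape map `Φν` is the period
mean of the REDUCED slow generator on the Riccati graph), crux idea `chang-slow-graph`, sketch `Cruxes/LagrangianRenormalisationStep/SlowGraphSketch.lean`
§G «the abstract lever», G1; the Cruxes sketch is not importable on the farm, so the body of its `def RiccatiInvariantBall : Prop` is restated here
VERBATIM as a theorem and proved).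

THE LEVER.  A linear slow–fast block system `ẋ = A₁₁x + A₁₂z`, `ż = A₂₁x + A₂₂z` on real inner-product spaces `E` (slow), `F` (fast), with a
`γ`-DISSIPATIVE fast block `⟪A₂₂ z, z⟫ ≤ −γ‖z‖²`, slow block `‖A₁₁‖ ≤ s₀ < γ` and couplings `‖A₁₂‖, ‖A₂₁‖ ≤ δ`, `8δ² ≤ (γ−s₀)²`: every solution of
CHANG'S RICCATI EQUATION `L̇ = A₂₁ + A₂₂L − LA₁₁ − LA₁₂L` starting in the ball `‖L‖ ≤ r := 2δ/(γ−s₀)` stays in it (`riccatiInvariantBall`).  Kokotović–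
Bensoussan–Blankenship 1987 §2 eq. (2.29), Thm 2.3 (Chang 1969/1972) prove existence + `O(ε)` approximation under a HURWITZ hypothesis on the fast
block; the version here replaces it by energy dissipativity, which is what makes the radius dimension-free (the Galerkin cell system at one Bloch
momentum is the instance, uniformly in the truncation).
PROOF (operator-norm right-Dini estimate, no spectral input).  For `‖ξ‖ = 1`, `u = ‖Lξ‖ ≤ N = ‖L‖`:
`⟪Lξ, L̇ξ⟫ ≤ (δ + N s₀) u − (γ − N δ) u²` (`inner_apply_riccati_le`), whence the first-order Taylor point obeys
`‖L + hL̇‖ ≤ N + h·q(N) + o(h)`, `q(N) = δ + N s₀ − γ N + δ N²` (`norm_add_smul_riccati_le`, monotonicity of `(1−2hb)u² + 2hau` in `u ≤ N`), so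
the lower right Dini derivative of `t ↦ ‖L t‖` is `≤ q(‖L t‖)` (`frequently_slope_norm_lt_of_hasDerivAt`); since `q(r) = δ(r² − 1) < 0` for
`δ > 0` (`r ≤ 1/√2`) the fencing theorem `image_le_of_liminf_slope_right_lt_deriv_boundary'` closes, and for `δ = 0`, `q ≤ 0` everywhere and
`image_le_of_liminf_slope_right_le_deriv_boundary` gives `L ≡ 0`.
No named facts, no sorry.  Infrastructure for route-1's rung leaf F-D1.A0 (frontier FORMAL rung); NOT a proof of the stub, of the crux, of Onsager's
conjecture or of anomalous dissipation.  Prover seat `ad-k1l-cellLawV-w1` g3, 2026-08-28.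

## References
* P. V. Kokotović, A. Bensoussan, G. L. Blankenship (eds.), *Singular Perturbations and Asymptotic Analysis in Control Systems*, LNCIS 90,
  Springer 1987, §2 eq. (2.29), Thm 2.3; §3 eq. (3.3)–(3.7) [corpus: book:kokotovic1987, pp. 11–12].
* K. W. Chang, *Singular perturbations of a general boundary value problem*, SIAM J. Math. Anal. 3 (1972) 520–526.
-/

set_option linter.dupNamespace false

noncomputable section

namespace Summit.AnomalousDissipation.AnomalousDissipation.Theorems.SolenoidalFractalHomogenisation.LagrangianStep

namespace SlowGraph

open Set Filter Topology
open scoped InnerProductSpace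

/-! ## §1 A right-Dini estimate for the norm along a differentiable path -/

section Dini

variable {G : Type*} [NormedAddCommGroup G] [NormedSpace ℝ G]

/-- If `L` has derivative `L'` at `x` and the first-order Taylor point satisfies `‖L x + h • L'‖ ≤ ‖L x‖ + h·r'` for small `h > 0`, then for
every `r > r'` the right slopes of `t ↦ ‖L t‖` at `x` are frequently (indeed eventually) `< r` — the lower right Dini derivative of the norm is
`≤ r'`. [folklore] -/
theorem frequently_slope_norm_lt_of_hasDerivAt {L : ℝ → G} {L' : G} {x r' r : ℝ} (hL : HasDerivAt L L' x)
    (hr' : ∃ η > 0, ∀ h ∈ Ioo 0 η, ‖L x + h • L'‖ ≤ ‖L x‖ + h * r') (hr : r' < r) :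
    ∃ᶠ z in 𝓝[>] x, slope (fun t => ‖L t‖) x z < r := by
  obtain ⟨η, hη, hTaylor⟩ := hr'
  have hε : 0 < (r - r') / 2 := by linarith
  have hsmall : ∀ᶠ z in 𝓝 x, ‖L z - L x - (z - x) • L'‖ ≤ (r - r') / 2 * ‖z - x‖ := hL.isLittleO.def hε
  have hsmall' : ∀ᶠ z in 𝓝[>] x, ‖L z - L x - (z - x) • L'‖ ≤ (r - r') / 2 * ‖z - x‖ :=
    nhdsWithin_le_nhds hsmall
  have hIoo : ∀ᶠ z in 𝓝[>] x, z ∈ Ioo x (x + η) := Ioo_mem_nhdsGT (by linarith)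
  refine Filter.Eventually.frequently ?_
  filter_upwards [hsmall', hIoo] with z hz hzI
  have hzx : 0 < z - x := by linarith [hzI.1]
  have hh : z - x ∈ Ioo 0 η := ⟨hzx, by linarith [hzI.2]⟩
  have h1 : ‖L z‖ ≤ ‖L x + (z - x) • L'‖ + ‖L z - L x - (z - x) • L'‖ := by
    have e : L z = (L x + (z - x) • L') + (L z - L x - (z - x) • L') := by abel
    calc ‖L z‖ = ‖(L x + (z - x) • L') + (L z - L x - (z - x) • L')‖ := by rw [← e]
      _ ≤ ‖L x + (z - x) • L'‖ + ‖L z - L x - (z - x) • L'‖ := norm_add_le _ _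
  have h2 : ‖L z‖ ≤ ‖L x‖ + (z - x) * r' + (r - r') / 2 * (z - x) := by
    have hn : ‖z - x‖ = z - x := by rw [Real.norm_eq_abs, abs_of_pos hzx]
    calc ‖L z‖ ≤ ‖L x + (z - x) • L'‖ + ‖L z - L x - (z - x) • L'‖ := h1
      _ ≤ (‖L x‖ + (z - x) * r') + (r - r') / 2 * ‖z - x‖ := add_le_add (hTaylor _ hh) hz
      _ = ‖L x‖ + (z - x) * r' + (r - r') / 2 * (z - x) := by rw [hn]
  rw [slope_def_field]
  rw [div_lt_iff₀ hzx]
  nlinarith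

end Dini

/-! ## §2 The Riccati vector field in a dissipative energy norm: the Taylor-point estimate -/

section Field

variable {E F : Type*} [NormedAddCommGroup E] [InnerProductSpace ℝ E] [NormedAddCommGroup F] [InnerProductSpace ℝ F]

/- Notation of the docstrings: Chang's Riccati vector field is `L̇ = A₂₁ + A₂₂L − LA₁₁ − LA₁₂L` (the right-hand side of `SlowGraphSketch` G1–G3,
written out in every statement), and the DINI GAIN at `‖L‖ = N` is `q(N) = δ + N s₀ − γ N + δ N²`. -/

variable {A₁₁ : E →L[ℝ] E} {A₁₂ : F →L[ℝ] E} {A₂₁ : E →L[ℝ] F} {A₂₂ : F →L[ℝ] F} {γ δ s₀ : ℝ}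

/-- **The energy inequality behind the lever**: for a `γ`-dissipative fast block, slow block `‖A₁₁‖ ≤ s₀`, couplings `≤ δ` and `N = ‖L‖`,
`⟪Lξ, (A₂₁ + A₂₂L − LA₁₁ − LA₁₂L)ξ⟫ ≤ (δ + N s₀)‖ξ‖‖Lξ‖ − (γ − N δ)‖Lξ‖²`. [folklore] -/
theorem inner_apply_riccati_le (hA₂₂ : ∀ z : F, ⟪A₂₂ z, z⟫_ℝ ≤ -γ * ‖z‖ ^ 2) (h₁₁ : ‖A₁₁‖ ≤ s₀) (h₁₂ : ‖A₁₂‖ ≤ δ)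
    (h₂₁ : ‖A₂₁‖ ≤ δ) (L : E →L[ℝ] F) (ξ : E) :
    ⟪L ξ, (A₂₁ + A₂₂.comp L - L.comp A₁₁ - (L.comp A₁₂).comp L) ξ⟫_ℝ ≤
      (δ + ‖L‖ * s₀) * (‖ξ‖ * ‖L ξ‖) - (γ - ‖L‖ * δ) * ‖L ξ‖ ^ 2 := by
  have hδ : 0 ≤ δ := le_trans (norm_nonneg _) h₁₂
  have hs₀ : 0 ≤ s₀ := le_trans (norm_nonneg _) h₁₁
  simp only [FunLike.coe_sub, FunLike.coe_add, Pi.sub_apply, Pi.add_apply,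
    ContinuousLinearMap.comp_apply, inner_sub_right, inner_add_right]
  -- the four terms
  have t1 : ⟪L ξ, A₂₁ ξ⟫_ℝ ≤ δ * (‖ξ‖ * ‖L ξ‖) := by
    calc ⟪L ξ, A₂₁ ξ⟫_ℝ ≤ ‖L ξ‖ * ‖A₂₁ ξ‖ := real_inner_le_norm _ _
      _ ≤ ‖L ξ‖ * (δ * ‖ξ‖) := mul_le_mul_of_nonneg_left ((A₂₁.le_opNorm ξ).trans (mul_le_mul_of_nonneg_right h₂₁ (norm_nonneg _))) (norm_nonneg _)
      _ = δ * (‖ξ‖ * ‖L ξ‖) := by ring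
  have t2 : ⟪L ξ, A₂₂ (L ξ)⟫_ℝ ≤ -γ * ‖L ξ‖ ^ 2 := by
    rw [real_inner_comm]; exact hA₂₂ _
  have t3 : ⟪L ξ, L (A₁₁ ξ)⟫_ℝ ≥ -(‖L‖ * s₀ * (‖ξ‖ * ‖L ξ‖)) := by
    have h : |⟪L ξ, L (A₁₁ ξ)⟫_ℝ| ≤ ‖L ξ‖ * ‖L (A₁₁ ξ)‖ := abs_real_inner_le_norm _ _
    have h' : ‖L (A₁₁ ξ)‖ ≤ ‖L‖ * (s₀ * ‖ξ‖) :=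
      (L.le_opNorm _).trans (mul_le_mul_of_nonneg_left ((A₁₁.le_opNorm ξ).trans (mul_le_mul_of_nonneg_right h₁₁ (norm_nonneg _))) (norm_nonneg _))
    have h'' : ‖L ξ‖ * ‖L (A₁₁ ξ)‖ ≤ ‖L‖ * s₀ * (‖ξ‖ * ‖L ξ‖) := by
      calc ‖L ξ‖ * ‖L (A₁₁ ξ)‖ ≤ ‖L ξ‖ * (‖L‖ * (s₀ * ‖ξ‖)) := mul_le_mul_of_nonneg_left h' (norm_nonneg _)
        _ = ‖L‖ * s₀ * (‖ξ‖ * ‖L ξ‖) := by ring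
    have := (abs_le.mp (h.trans h'')).1
    linarith
  have t4 : ⟪L ξ, L (A₁₂ (L ξ))⟫_ℝ ≥ -(‖L‖ * δ * ‖L ξ‖ ^ 2) := by
    have h : |⟪L ξ, L (A₁₂ (L ξ))⟫_ℝ| ≤ ‖L ξ‖ * ‖L (A₁₂ (L ξ))‖ := abs_real_inner_le_norm _ _
    have h' : ‖L (A₁₂ (L ξ))‖ ≤ ‖L‖ * (δ * ‖L ξ‖) :=
      (L.le_opNorm _).trans (mul_le_mul_of_nonneg_left ((A₁₂.le_opNorm _).trans (mul_le_mul_of_nonneg_right h₁₂ (norm_nonneg _))) (norm_nonneg _))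
    have h'' : ‖L ξ‖ * ‖L (A₁₂ (L ξ))‖ ≤ ‖L‖ * δ * ‖L ξ‖ ^ 2 := by
      calc ‖L ξ‖ * ‖L (A₁₂ (L ξ))‖ ≤ ‖L ξ‖ * (‖L‖ * (δ * ‖L ξ‖)) := mul_le_mul_of_nonneg_left h' (norm_nonneg _)
        _ = ‖L‖ * δ * ‖L ξ‖ ^ 2 := by ring
    have := (abs_le.mp (h.trans h'')).1
    linarith
  nlinarith [t1, t2, t3, t4]

/-- **The Taylor-point estimate**: with `N = ‖L‖`, `L̇ = A₂₁ + A₂₂L − LA₁₁ − LA₁₂L`, for every `r' > q(N)` and all small `h > 0`,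
`‖L + h L̇‖ ≤ N + h·r'`.  (For `‖ξ‖ = 1`, `u = ‖Lξ‖ ≤ N`: `‖(L + hL̇)ξ‖² ≤ (1 − 2hb)u² + 2hau + h²‖L̇‖²` with `a = δ + Ns₀ ≥ 0`, `b = γ − Nδ`, monotone
in `u` once `2hb ≤ 1`, hence `≤ N² + 2hN q(N) + h²‖L̇‖² ≤ (N + hr')²`.) [folklore] -/
theorem norm_add_smul_riccati_le (hA₂₂ : ∀ z : F, ⟪A₂₂ z, z⟫_ℝ ≤ -γ * ‖z‖ ^ 2) (h₁₁ : ‖A₁₁‖ ≤ s₀) (h₁₂ : ‖A₁₂‖ ≤ δ)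
    (h₂₁ : ‖A₂₁‖ ≤ δ) (L : E →L[ℝ] F) {r' : ℝ} (hr' : δ + ‖L‖ * s₀ - γ * ‖L‖ + δ * ‖L‖ ^ 2 < r') :
    ∃ η > 0, ∀ h ∈ Ioo 0 η, ‖L + h • (A₂₁ + A₂₂.comp L - L.comp A₁₁ - (L.comp A₁₂).comp L)‖ ≤ ‖L‖ + h * r' := by
  have hδ : 0 ≤ δ := le_trans (norm_nonneg _) h₁₂
  have hs₀ : 0 ≤ s₀ := le_trans (norm_nonneg _) h₁₁
  set L' := A₂₁ + A₂₂.comp L - L.comp A₁₁ - (L.comp A₁₂).comp L with hL'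
  set N := ‖L‖ with hN
  have hN0 : 0 ≤ N := norm_nonneg _
  rcases hN0.eq_or_lt with hN00 | hNpos
  · -- `L = 0`: the Taylor point is `h • A₂₁`
    have hL0 : L = 0 := by rw [← norm_eq_zero]; exact hN00.symm
    have hq : δ < r' := by simpa [← hN00] using hr'
    refine ⟨1, one_pos, fun h hh => ?_⟩
    have hL'eq : L' = A₂₁ := by simp [hL', hL0]
    rw [hL0, zero_add, hL'eq, norm_smul, Real.norm_eq_abs, abs_of_pos hh.1, ← hN00]
    simp only [zero_add]
    exact mul_le_mul_of_nonneg_left (h₂₁.trans hq.le) hh.1.le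
  · -- `N > 0`
    set q := δ + N * s₀ - γ * N + δ * N ^ 2 with hq
    set a := δ + N * s₀ with ha
    set b := γ - N * δ with hb
    set C := ‖L'‖ ^ 2 with hC
    have ha0 : 0 ≤ a := by rw [ha]; positivity
    have hC0 : 0 ≤ C := by rw [hC]; positivity
    have hqr : 0 < r' - q := by linarith
    -- the window for `h`
    set η := min (1 / (2 * |b| + 1)) (min (N / (|r'| + 1)) (2 * N * (r' - q) / (|C - r' ^ 2| + 1))) with hη
    have hη1 : 0 < 1 / (2 * |b| + 1) := by positivity
    have hη2 : 0 < N / (|r'| + 1) := by positivity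
    have hη3 : 0 < 2 * N * (r' - q) / (|C - r' ^ 2| + 1) := by positivity
    have hηpos : 0 < η := lt_min hη1 (lt_min hη2 hη3)
    refine ⟨η, hηpos, fun h hh => ?_⟩
    have hh0 : 0 < h := hh.1
    have hhle1 : h < 1 / (2 * |b| + 1) := lt_of_lt_of_le hh.2 (min_le_left _ _)
    have hhle2 : h < N / (|r'| + 1) := lt_of_lt_of_le hh.2 ((min_le_right _ _).trans (min_le_left _ _))
    have hhle3 : h < 2 * N * (r' - q) / (|C - r' ^ 2| + 1) := lt_of_lt_of_le hh.2 ((min_le_right _ _).trans (min_le_right _ _))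
    -- (i) `2 h b ≤ 1`
    have hi : 0 ≤ 1 - 2 * h * b := by
      have h1 : h * (2 * |b| + 1) < 1 := by rwa [lt_div_iff₀ (by positivity)] at hhle1
      have h2 : 2 * h * b ≤ 2 * h * |b| := by nlinarith [le_abs_self b]
      nlinarith [abs_nonneg b]
    -- (ii) `N + h r' ≥ 0`
    have hii : 0 ≤ N + h * r' := by
      have h1 : h * (|r'| + 1) < N := by rwa [lt_div_iff₀ (by positivity)] at hhle2
      have h2 : -(h * |r'|) ≤ h * r' := by nlinarith [neg_abs_le r']
      nlinarith [abs_nonneg r']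
    -- (iii) `h (C - r'^2) ≤ 2 N (r' - q)`
    have hiii : h * (C - r' ^ 2) ≤ 2 * N * (r' - q) := by
      have h1 : h * (|C - r' ^ 2| + 1) < 2 * N * (r' - q) := by rwa [lt_div_iff₀ (by positivity)] at hhle3
      have h2 : h * (C - r' ^ 2) ≤ h * |C - r' ^ 2| := mul_le_mul_of_nonneg_left (le_abs_self _) hh0.le
      nlinarith [abs_nonneg (C - r' ^ 2)]
    -- pointwise estimate on the unit sphere
    refine ContinuousLinearMap.opNorm_le_of_unit_norm hii fun ξ hξ => ?_
    have hu : ‖L ξ‖ ≤ N := by simpa [hξ] using L.le_opNorm ξ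
    have hu0 : 0 ≤ ‖L ξ‖ := norm_nonneg _
    have hinner : ⟪L ξ, L' ξ⟫_ℝ ≤ a * ‖L ξ‖ - b * ‖L ξ‖ ^ 2 := by
      have := inner_apply_riccati_le hA₂₂ h₁₁ h₁₂ h₂₁ L ξ
      rw [← hL', hξ, one_mul] at this
      exact this
    have hL'ξ : ‖L' ξ‖ ^ 2 ≤ C := by
      rw [hC]
      have : ‖L' ξ‖ ≤ ‖L'‖ := by simpa [hξ] using L'.le_opNorm ξ
      exact pow_le_pow_left₀ (norm_nonneg _) this 2
    have hsq : ‖(L + h • L') ξ‖ ^ 2 ≤ (N + h * r') ^ 2 := by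
      have e1 : (L + h • L') ξ = L ξ + h • L' ξ := by simp
      rw [e1, norm_add_sq_real, real_inner_smul_right, norm_smul, Real.norm_eq_abs, abs_of_pos hh0]
      -- `u² + 2h⟪Lξ, L'ξ⟫ + h²‖L'ξ‖² ≤ (1-2hb)u² + 2hau + h²C ≤ (1-2hb)N² + 2haN + h²C ≤ (N + h r')²`
      have s1 : ‖L ξ‖ ^ 2 + 2 * (h * ⟪L ξ, L' ξ⟫_ℝ) + (h * ‖L' ξ‖) ^ 2 ≤
          (1 - 2 * h * b) * ‖L ξ‖ ^ 2 + 2 * h * a * ‖L ξ‖ + h ^ 2 * C := by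
        have p4 : h * ⟪L ξ, L' ξ⟫_ℝ ≤ h * (a * ‖L ξ‖ - b * ‖L ξ‖ ^ 2) := mul_le_mul_of_nonneg_left hinner hh0.le
        have p5 : (h * ‖L' ξ‖) ^ 2 ≤ h ^ 2 * C := by
          rw [mul_pow]; exact mul_le_mul_of_nonneg_left hL'ξ (sq_nonneg _)
        have e : (1 - 2 * h * b) * ‖L ξ‖ ^ 2 + 2 * h * a * ‖L ξ‖ + h ^ 2 * C =
            ‖L ξ‖ ^ 2 + 2 * (h * (a * ‖L ξ‖ - b * ‖L ξ‖ ^ 2)) + h ^ 2 * C := by ring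
        rw [e]; linarith
      have s2 : (1 - 2 * h * b) * ‖L ξ‖ ^ 2 + 2 * h * a * ‖L ξ‖ ≤ (1 - 2 * h * b) * N ^ 2 + 2 * h * a * N := by
        have p1 : ‖L ξ‖ ^ 2 ≤ N ^ 2 := pow_le_pow_left₀ hu0 hu 2
        have p2 : 0 ≤ 2 * h * a := by positivity
        exact add_le_add (mul_le_mul_of_nonneg_left p1 hi) (mul_le_mul_of_nonneg_left hu p2)
      have s3 : (1 - 2 * h * b) * N ^ 2 + 2 * h * a * N + h ^ 2 * C = N ^ 2 + 2 * h * N * q + h ^ 2 * C := by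
        simp only [hq, ha, hb]; ring
      have s4 : N ^ 2 + 2 * h * N * q + h ^ 2 * C ≤ (N + h * r') ^ 2 := by
        have p3 : 0 ≤ h * (2 * N * (r' - q) - h * (C - r' ^ 2)) := mul_nonneg hh0.le (sub_nonneg.mpr hiii)
        have e : (N + h * r') ^ 2 = (N ^ 2 + 2 * h * N * q + h ^ 2 * C) + h * (2 * N * (r' - q) - h * (C - r' ^ 2)) := by ring
        rw [e]; linarith
      linarith
    exact (pow_le_pow_iff_left₀ (norm_nonneg _) hii two_ne_zero).mp hsq

end Field

/-! ## §3 G1 — the invariant ball (`SlowGraphSketch.RiccatiInvariantBall`, VERBATIM body, PROVED) -/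

section Ball

variable {E F : Type*} [NormedAddCommGroup E] [InnerProductSpace ℝ E] [NormedAddCommGroup F] [InnerProductSpace ℝ F]

/-- The lower right Dini derivative of `t ↦ ‖L t‖` along the Riccati flow is at most the Dini gain `q(‖L t‖) = δ + ‖L t‖s₀ − γ‖L t‖ + δ‖L t‖²`.
[folklore] -/
theorem frequently_slope_norm_lt_riccati {A₁₁ : ℝ → E →L[ℝ] E} {A₁₂ : ℝ → F →L[ℝ] E} {A₂₁ : ℝ → E →L[ℝ] F} {A₂₂ : ℝ → F →L[ℝ] F}
    {L : ℝ → E →L[ℝ] F} {γ δ s₀ x : ℝ}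
    (hA₂₂ : ∀ z : F, ⟪A₂₂ x z, z⟫_ℝ ≤ -γ * ‖z‖ ^ 2) (h₁₁ : ‖A₁₁ x‖ ≤ s₀) (h₁₂ : ‖A₁₂ x‖ ≤ δ) (h₂₁ : ‖A₂₁ x‖ ≤ δ)
    (hL : HasDerivAt L (A₂₁ x + (A₂₂ x).comp (L x) - (L x).comp (A₁₁ x) - ((L x).comp (A₁₂ x)).comp (L x)) x)
    {ρ : ℝ} (hρ : δ + ‖L x‖ * s₀ - γ * ‖L x‖ + δ * ‖L x‖ ^ 2 < ρ) :
    ∃ᶠ z in 𝓝[>] x, slope (fun t => ‖L t‖) x z < ρ := by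
  have hmid : δ + ‖L x‖ * s₀ - γ * ‖L x‖ + δ * ‖L x‖ ^ 2 < (δ + ‖L x‖ * s₀ - γ * ‖L x‖ + δ * ‖L x‖ ^ 2 + ρ) / 2 := by
    linarith
  have hT := norm_add_smul_riccati_le hA₂₂ h₁₁ h₁₂ h₂₁ (L x) hmid
  exact frequently_slope_norm_lt_of_hasDerivAt hL hT (by linarith)

/-- **G1 `SlowGraphSketch.RiccatiInvariantBall` (planner ad-ideate-p5, crux idea `chang-slow-graph`), VERBATIM body, PROVED — THE INVARIANT BALL.**
If the fast block is `γ`-dissipative, the slow block has norm `≤ s₀ < γ`, the couplings have norm `≤ δ` with `8δ² ≤ (γ−s₀)²`, then a solution of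
Chang's Riccati equation `L̇ = A₂₁ + A₂₂L − LA₁₁ − LA₁₂L` starting in the ball of radius `r = 2δ/(γ−s₀)` stays in it on `[0, T]`.  (Finite
dimensionality is carried by the registered text but not used.)  Kokotović–Bensoussan–Blankenship 1987 §2 eq. (2.29), Thm 2.3 (Chang 1969/1972), with the
Hurwitz hypothesis replaced by energy dissipativity. [cite: KokotovicBensoussanBlankenship1987, §2 eq. (2.29), Thm 2.3] -/
theorem riccatiInvariantBall : ∀ (E F : Type) [NormedAddCommGroup E] [InnerProductSpace ℝ E] [FiniteDimensional ℝ E]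
    [NormedAddCommGroup F] [InnerProductSpace ℝ F] [FiniteDimensional ℝ F]
    (A₁₁ : ℝ → E →L[ℝ] E) (A₁₂ : ℝ → F →L[ℝ] E) (A₂₁ : ℝ → E →L[ℝ] F) (A₂₂ : ℝ → F →L[ℝ] F)
    (L : ℝ → E →L[ℝ] F) (γ δ s₀ T : ℝ),
    0 < γ → 0 ≤ δ → 0 ≤ s₀ → s₀ < γ → 8 * δ ^ 2 ≤ (γ - s₀) ^ 2 → 0 ≤ T →
    (∀ t ∈ Icc 0 T, ∀ z : F, ⟪A₂₂ t z, z⟫_ℝ ≤ -γ * ‖z‖ ^ 2) →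
    (∀ t ∈ Icc 0 T, ‖A₁₁ t‖ ≤ s₀) → (∀ t ∈ Icc 0 T, ‖A₁₂ t‖ ≤ δ) → (∀ t ∈ Icc 0 T, ‖A₂₁ t‖ ≤ δ) →
    (∀ t ∈ Ico 0 T, HasDerivAt L (A₂₁ t + (A₂₂ t).comp (L t) - (L t).comp (A₁₁ t) - ((L t).comp (A₁₂ t)).comp (L t)) t) →
    ContinuousOn L (Icc 0 T) →
    ‖L 0‖ ≤ 2 * δ / (γ - s₀) → ∀ t ∈ Icc 0 T, ‖L t‖ ≤ 2 * δ / (γ - s₀) := by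
  intro E F _ _ _ _ _ _ A₁₁ A₁₂ A₂₁ A₂₂ L γ δ s₀ T _hγ hδ _hs₀ hsγ h8 _hT hA₂₂ h₁₁ h₁₂ h₂₁ hL hcont h0 t ht
  have hgs : 0 < γ - s₀ := by linarith
  have hcontn : ContinuousOn (fun t => ‖L t‖) (Icc 0 T) := continuous_norm.comp_continuousOn hcont
  have hf' : ∀ x ∈ Ico 0 T, ∀ ρ, δ + ‖L x‖ * s₀ - γ * ‖L x‖ + δ * ‖L x‖ ^ 2 < ρ →
      ∃ᶠ z in 𝓝[>] x, slope (fun t => ‖L t‖) x z < ρ :=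
    fun x hx ρ hρ => frequently_slope_norm_lt_riccati (hA₂₂ x (Ico_subset_Icc_self hx)) (h₁₁ x (Ico_subset_Icc_self hx))
      (h₁₂ x (Ico_subset_Icc_self hx)) (h₂₁ x (Ico_subset_Icc_self hx)) (hL x hx) hρ
  rcases hδ.eq_or_lt with hδ0 | hδpos
  · -- `δ = 0`: the radius is `0` and the Dini gain `N(s₀ − γ)` is `≤ 0` everywhere
    have hr0 : 2 * δ / (γ - s₀) = 0 := by rw [← hδ0]; simp
    rw [hr0] at h0 ⊢
    have key := image_le_of_liminf_slope_right_le_deriv_boundary (f := fun t => ‖L t‖) (B := fun _ => (0:ℝ)) (B' := fun _ => (0:ℝ))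
      hcontn h0 continuousOn_const (fun x _ => (hasDerivAt_const x (0:ℝ)).hasDerivWithinAt) ?_
    · exact key ht
    · intro x hx ρ hρ
      refine hf' x hx ρ (lt_of_le_of_lt ?_ hρ)
      have hN := norm_nonneg (L x)
      rw [← hδ0]
      nlinarith
  · -- `δ > 0`: `r < 1` and the Dini gain at the boundary is `δ(r² − 1) < 0`
    have h2δ : 2 * δ < γ - s₀ := by
      have h1 : (2 * δ) ^ 2 < (γ - s₀) ^ 2 := by nlinarith
      exact (pow_lt_pow_iff_left₀ (by positivity) hgs.le two_ne_zero).mp h1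
    have hr1 : 2 * δ / (γ - s₀) < 1 := (div_lt_one hgs).mpr h2δ
    have hr0 : 0 ≤ 2 * δ / (γ - s₀) := by positivity
    have key := image_le_of_liminf_slope_right_lt_deriv_boundary' (f := fun t => ‖L t‖)
      (f' := fun x => δ + ‖L x‖ * s₀ - γ * ‖L x‖ + δ * ‖L x‖ ^ 2) hcontn hf'
      (B := fun _ => 2 * δ / (γ - s₀)) (B' := fun _ => (0:ℝ)) h0 continuousOn_const
      (fun x _ => (hasDerivAt_const x (2 * δ / (γ - s₀))).hasDerivWithinAt) ?_
    · exact key ht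
    · intro x _ hxr
      rw [hxr]
      have e : δ + 2 * δ / (γ - s₀) * s₀ - γ * (2 * δ / (γ - s₀)) + δ * (2 * δ / (γ - s₀)) ^ 2 =
          δ * ((2 * δ / (γ - s₀)) ^ 2 - 1) := by
        field_simp
        ring
      rw [e]
      have : (2 * δ / (γ - s₀)) ^ 2 < 1 := by nlinarith
      nlinarith

end Ball

end SlowGraph

end Summit.AnomalousDissipation.AnomalousDissipation.Theorems.SolenoidalFractalHomogenisation.LagrangianStep

end
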